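import Summits.CriticalPhenomena.PercolationContinuityZ3.Theorems.Transplant.FKConnectivityAllQPat3Gluing
import Summits.CriticalPhenomena.PercolationContinuityZ3.Theorems.Transplant.FKConnectivityAllQPat3Levels
import HarnessLib

/-!
# Connectivity correlation inequalities for `φ_{w,q}`, every `q > 0` — the ONE-SIDED ONE-VERTEX GLUING LAW for three-point tables

Proof file (`--supports stmt-CriticalPhenomena-4575`), census lineage (gen 37) of LANE 2's FK sub-programme; builds on p205010
(kernel theorem, internal audit signed; external expert review pending).  No definitions, no named facts, no sorries.

Census g26/g32's one-sided 1-cut law (FROM-census-g32-TWO-SUMS §1.4: "for `|S| ≤ 1` a plain convolution") in the kernel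
vocabulary of `…Pat3Levels.lean`: if `E₂` is glued to `E₁` along at most ONE vertex `m` (`V₁ ∩ V₂ ⊆ {m}`) and the three marks
`b, s, t` all lie on the `E₁` side (each off `V₂` or equal to `m`), then the three-point pattern of a glued configuration is the
pattern of its `E₁`-part (`FK.pat3_union_oneSided`), the antipodal exponent is additive (fk-2's `FK.apExp_series`), and hence the
levelwise value of ANY two-level table on the union is a nonnegative combination of levelwise values on `E₁`
(`FK.lev2_union_oneSided_nonneg`: levelwise nonnegativity on `E₁` ⇒ on `E₁ ∪ E₂`).  Used by the structural recursion of THEOREM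
SP (`…Pat3SPSteps.lean`, census g37) for a pendant block hanging at a mark or at an unmarked vertex away from the marks.
[cite: Grimmett2006, §3.8 (pp. 61–62)] [cite: AyyerLinussonRavichandran2025, §7 (p. 22)]
-/

namespace Summit.CriticalPhenomena.PercolationContinuityZ3.Theorems

namespace FK

open SimpleGraph Literature.Probability.LatticeModels Literature.Probability.Percolation
open scoped Classical

variable {V : Type*}

section OneSided

variable {E₁ E₂ : Finset (Sym2 V)} {V₁ V₂ : Set V}

/-- One-vertex gluing (interface inside `{m}`): two distinct points of the first side, each off the second side or equal to `m`,
are joined in `γ₁ ∪ γ₂` iff they are joined inside `γ₁`. [folklore] -/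
theorem reachable_union_oneSided (h₁ : ∀ e ∈ (↑E₁ : Set (Sym2 V)), ∀ z ∈ e, z ∈ V₁)
    (h₂ : ∀ e ∈ (↑E₂ : Set (Sym2 V)), ∀ z ∈ e, z ∈ V₂) {m : V} (hS : V₁ ∩ V₂ ⊆ {m}) {p q : V} (hp : p ∉ V₂ ∨ p = m)
    (hq : q ∉ V₂ ∨ q = m) (hpq : p ≠ q) {γ₁ γ₂ : Finset (Sym2 V)} (hγ₁ : γ₁ ⊆ E₁) (hγ₂ : γ₂ ⊆ E₂) :
    (openGraph (↑(γ₁ ∪ γ₂) : BondConfig V)).Reachable p q ↔ (openGraph (↑γ₁ : BondConfig V)).Reachable p q := by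
  rcases hp with hp | rfl
  · rcases hq with hq | rfl
    · exact reachable_union_off_right h₁ h₂ hS hp hq hγ₁ hγ₂
    · exact reachable_union_mid_left h₁ h₂ hS hp hγ₁ hγ₂
  · rcases hq with hq | rfl
    · rw [SimpleGraph.reachable_comm, reachable_union_mid_left h₁ h₂ hS hq hγ₁ hγ₂, SimpleGraph.reachable_comm]
    · exact absurd rfl hpq

/-- **One-sided one-vertex gluing, patterns**: with all three (distinct) marks on the first side (off the second side or at the
interface vertex `m`), the pattern of `γ₁ ∪ γ₂` is the pattern of `γ₁`. [folklore] -/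
theorem pat3_union_oneSided (h₁ : ∀ e ∈ (↑E₁ : Set (Sym2 V)), ∀ z ∈ e, z ∈ V₁)
    (h₂ : ∀ e ∈ (↑E₂ : Set (Sym2 V)), ∀ z ∈ e, z ∈ V₂) {m : V} (hS : V₁ ∩ V₂ ⊆ {m}) {b s t : V} (hb : b ∉ V₂ ∨ b = m)
    (hs : s ∉ V₂ ∨ s = m) (ht : t ∉ V₂ ∨ t = m) (hbs : b ≠ s) (hbt : b ≠ t) (hst : s ≠ t) {γ₁ γ₂ : Finset (Sym2 V)}
    (hγ₁ : γ₁ ⊆ E₁) (hγ₂ : γ₂ ⊆ E₂) : pat3 (γ₁ ∪ γ₂) b s t = pat3 γ₁ b s t := by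
  refine pat3_eq_of_iff ?_ ?_ ?_
  · rw [reachable_union_oneSided h₁ h₂ hS hb hs hbs hγ₁ hγ₂, pat3_xy_iff]
  · rw [reachable_union_oneSided h₁ h₂ hS hb ht hbt hγ₁ hγ₂, pat3_xs_iff]
  · rw [reachable_union_oneSided h₁ h₂ hS hs ht hst hγ₁ hγ₂, pat3_ys_iff]

variable [Fintype V]

/-- **One-sided one-vertex gluing law, levelwise** (census g26/g32 §1.4 for `|S| ≤ 1`): if a two-level table `F` is levelwise
nonnegative on `(E₁; b, s, t)` and `E₂` is glued along at most the one vertex `m` with the marks on the `E₁` side, then `F` is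
levelwise nonnegative on `(E₁ ∪ E₂; b, s, t)` — the union's value at a level is the sum over the configurations `γ₂ ⊆ E₂` of
values on `E₁` at shifted levels. [cite: AyyerLinussonRavichandran2025, §7 (p. 22)] -/
theorem lev2_union_oneSided_nonneg (hd : Disjoint E₁ E₂) (h₁ : ∀ e ∈ (↑E₁ : Set (Sym2 V)), ∀ z ∈ e, z ∈ V₁)
    (h₂ : ∀ e ∈ (↑E₂ : Set (Sym2 V)), ∀ z ∈ e, z ∈ V₂) {m : V} (hS : V₁ ∩ V₂ ⊆ {m}) {b s t : V} (hb : b ∉ V₂ ∨ b = m)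
    (hs : s ∉ V₂ ∨ s = m) (ht : t ∉ V₂ ∨ t = m) (hbs : b ≠ s) (hbt : b ≠ t) (hst : s ≠ t) (F : ℕ → Pat3 → Pat3 → ℤ)
    (hA : ∀ μ : ℕ, 0 ≤ lev2 E₁ b s t F μ) (μ : ℕ) : 0 ≤ lev2 (E₁ ∪ E₂) b s t F μ := by
  unfold lev2
  rw [sum_powerset_union_disj hd, Finset.sum_comm]
  refine Finset.sum_nonneg fun γ₂ hγ₂ => ?_
  have g₂ := Finset.mem_powerset.1 hγ₂
  by_cases ha : apExp E₂ γ₂ ≤ μ + 2 * Fintype.card V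
  · have key := hA (μ + 2 * Fintype.card V - apExp E₂ γ₂)
    unfold lev2 at key
    refine le_of_le_of_eq key (Finset.sum_congr rfl fun γ₁ hγ₁ => ?_)
    have g₁ := Finset.mem_powerset.1 hγ₁
    have hexp := apExp_series hd h₁ h₂ hS le_rfl le_rfl g₁ g₂
    rw [union_sdiff_union hd g₁ g₂, pat3_union_oneSided h₁ h₂ hS hb hs ht hbs hbt hst g₁ g₂,
      pat3_union_oneSided h₁ h₂ hS hb hs ht hbs hbt hst Finset.sdiff_subset Finset.sdiff_subset]
    have e1 : (apExp E₁ γ₁ = μ + 2 * Fintype.card V - apExp E₂ γ₂) ↔ (apExp (E₁ ∪ E₂) (γ₁ ∪ γ₂) = μ) := by omega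
    have e2 : (apExp E₁ γ₁ + 1 = μ + 2 * Fintype.card V - apExp E₂ γ₂) ↔ (apExp (E₁ ∪ E₂) (γ₁ ∪ γ₂) + 1 = μ) := by omega
    rw [ite_eq_ite_of_iff e1 rfl, ite_eq_ite_of_iff e2 rfl]
  · refine le_of_eq (Finset.sum_eq_zero fun γ₁ hγ₁ => ?_).symm
    have g₁ := Finset.mem_powerset.1 hγ₁
    have hexp := apExp_series hd h₁ h₂ hS le_rfl le_rfl g₁ g₂
    rw [if_neg (by omega), if_neg (by omega), add_zero]

end OneSided

end FK

end Summit.CriticalPhenomena.PercolationContinuityZ3.Theorems
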